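import Literature.NumberTheory.Sieve.LargestPrimeFactorCubicS1Decomp
import Literature.NumberTheory.Sieve.LargestPrimeFactorCubicRemainder
import HarnessLib

/-!
# Heath-Brown 2001, Lemma 4 for one family of generators: `|∑_c R(α_c)|` through the
# exponential sums `σ(n) = ∑_c e(nX'/N(α_c)) e_q(−n ab C̄)` ((2.9) with (3.5))

Thirteenth proved layer of this seat under the named fact `HeathBrown2001_largestPrimeFactor_cubic`
(`LargestPrimeFactorCubic.lean`; D. R. Heath-Brown, *The largest prime factor of `X³ + 2`*, Proc.
London Math. Soc. (3) 82 (2001) 554–596).  After (5.1) (`…S1Decomp.abs_S1sum_le`) it remains to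
bound, for a fixed cube, pair `(a, b)`, modulus `e = pd` and root class `j`, the inner sum
`∑_{c ∈ 𝒞(a,b), e ∣ a+bj+cj²} R(α_c)` of remainders `R(α) = #𝒜_{(α)} − X/N(α)`.  Lemma 4 (p. 562)
does this for "`J` run[ning] over integers `α` for which `a` and `b` are fixed" ((2.9)):

> `∑_{J∈𝒥} R_J ≪ (log H)(H⁻¹ + HN³M⁻⁶)#𝒥 + (log H) ∑_{n ≤ H²} min(n⁻¹, Hn⁻²)|σ(n)|`,
> `σ(n) = ∑_{J∈𝒥} e_q(−nabC̄) e(nX'/N(α))`.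

This file PROVES the corresponding statement for our families (`abs_sum_Rv_le`), assembling
`…Remainder` (the `R_J` as sawtooth values and their sums, (3.4)) with the first part of Lemma 4
(`…Generators`: `ρ((α)) = 1`, `k_J ≡ −BC̄`, and (3.5)):

* `uRoot`, `kRoot`, `wRoot` — the inverse `u` of `C = b² − ac` modulo `N(α)`, the root class
  `k = −uB` (`B = 2c² − ab`), and the inverse `w` of `C` modulo `q = a³ − 2b³`, for `α ∈ gens`;
  `Acount_eq_card_filter` — `#𝒜_{(α)} = #{X < n ≤ 2X : N(α) ∣ n − k}`;
* `exists_int_phase` — (3.5) in real form: `(X' − k)/N(α) − (X'/N(α) − abw/q) + E/(qN(α)) ∈ ℤ`,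
  `E = 2a²c + 4bc² − 4ab²`, and `abs_E_div_le` — `|E/(qN(α))| ≤ 1/(4X)` (Heath-Brown's `O(N³M⁻⁶)`);
* `abs_sum_Rv_le` — with `σ_{X'}(h) = ∑_c e(h(X'/N(α_c) − ab w_c/q))`, `V ≥ 1`, `H = 5(2V+1)`,
  `c_V = 3(2 + log(2V+1))/(2V+1)`:
  `|∑_c R(α_c)| ≤ ∑_{X'∈{X,2X}} [(1/π)∑_{ν≤V} |σ_{X'}(ν)|/ν + c_V ∑_{|h|≤H} |σ_{X'}(h)|]
   + 2 (#𝒥/(4X)) (2V + 2π c_V ∑_{|h|≤H} |h|)`.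

## References

* D. R. Heath-Brown, *The largest prime factor of `X³ + 2`*, Proc. London Math. Soc. (3) 82 (2001)
  554–596, Lemma 4 (p. 562, (2.9)), §3 pp. 566–568 ((3.4)–(3.5)), §5 p. 571.
  [`HeathBrown2001LargestPrimeFactorCubic`]
-/

noncomputable section

open NumberField Finset Real
open scoped FourierTransform

namespace Literature.NumberTheory.Sieve.LargestPrimeFactorCubic

open LFunctions.CubeRootTwoField CubicSieve
open Literature.NumberTheory.LFunctions.AFE (saw)

/-! ### `C`, `B`, `E` and the roots `u`, `k`, `w` of a generator -/

/-- `C = b² − ac`. [cite: HeathBrown2001LargestPrimeFactorCubic, Lemma 4] -/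
def Cf (v : ℕ × ℕ × ℕ) : ℤ := (v.2.1 : ℤ) ^ 2 - v.1 * v.2.2

/-- `B = 2c² − ab`. [cite: HeathBrown2001LargestPrimeFactorCubic, §3 p. 565] -/
def Bf (v : ℕ × ℕ × ℕ) : ℤ := 2 * (v.2.2 : ℤ) ^ 2 - v.1 * v.2.1

/-- `E = 2a²c + 4bc² − 4ab²` (the numerator in (3.5)). [cite: HeathBrown2001LargestPrimeFactorCubic, (3.5)] -/
def Ef (v : ℕ × ℕ × ℕ) : ℤ := 2 * (v.1 : ℤ) ^ 2 * v.2.2 + 4 * v.2.1 * (v.2.2 : ℤ) ^ 2 - 4 * v.1 * (v.2.1 : ℤ) ^ 2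

/-- The inverse `u` of `C` modulo `N(α)` (when `(C, q) = 1`; else `0`).
[cite: HeathBrown2001LargestPrimeFactorCubic, §3 p. 566] -/
def uRoot (v : ℕ × ℕ × ℕ) : ℤ :=
  if h : IsCoprime ((v.2.1 : ℤ) ^ 2 - v.1 * v.2.2) ((v.1 : ℤ) ^ 3 - 2 * (v.2.1 : ℤ) ^ 3) then
    Classical.choose (exists_inverse_C h) else 0

/-- The inverse `w` of `C` modulo `q` (when `(C, q) = 1`; else `0`): Heath-Brown's `C̄^{(q)}`.
[cite: HeathBrown2001LargestPrimeFactorCubic, (3.5)] -/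
def wRoot (v : ℕ × ℕ × ℕ) : ℤ :=
  if h : IsCoprime ((v.2.1 : ℤ) ^ 2 - v.1 * v.2.2) ((v.1 : ℤ) ^ 3 - 2 * (v.2.1 : ℤ) ^ 3) then
    Classical.choose (exists_inverse_C_mod_q h) else 0

/-- The root class `k = −uB` of `(α)`: `n + ∛2 ∈ (α) ↔ n ≡ k (mod N(α))` (Lemma 4, `k ≡ −BC̄`).
[cite: HeathBrown2001LargestPrimeFactorCubic, Lemma 4] -/
def kRoot (v : ℕ × ℕ × ℕ) : ℤ := -(uRoot v * Bf v)

section Spec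

variable {X : ℕ} {P : ℕ → Finset (ℕ × ℕ)}

/-- Auxiliary fact `uRoot_spec` for this file's estimates. [folklore] -/
theorem uRoot_spec (hP : ∀ i, P i ⊆ basePairs X i) {v : ℕ × ℕ × ℕ} (hv : v ∈ gens X P) :
    uRoot v * Cf v ≡ 1 [ZMOD normf v] := by
  obtain ⟨-, hC, -⟩ := isCoprime_of_mem_gens hP hv
  rw [uRoot, dif_pos hC]
  have h := Classical.choose_spec (exists_inverse_C hC)
  simpa [Cf, normf] using h

/-- Auxiliary fact `wRoot_spec` for this file's estimates. [folklore] -/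
theorem wRoot_spec (hP : ∀ i, P i ⊆ basePairs X i) {v : ℕ × ℕ × ℕ} (hv : v ∈ gens X P) :
    wRoot v * Cf v ≡ 1 [ZMOD qf v.1 v.2.1] := by
  obtain ⟨-, hC, -⟩ := isCoprime_of_mem_gens hP hv
  rw [wRoot, dif_pos hC]
  have h := Classical.choose_spec (exists_inverse_C_mod_q hC)
  simpa [Cf, qf] using h

/-- `∛2 ≡ uB (mod (α))`. [cite: HeathBrown2001LargestPrimeFactorCubic, Lemma 4] -/
theorem θint_sub_uB_mem (hP : ∀ i, P i ⊆ basePairs X i) {v : ℕ × ℕ × ℕ} (hv : v ∈ gens X P) :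
    θint - ((uRoot v * Bf v : ℤ) : 𝓞 K) ∈ genIdeal v := by
  obtain ⟨a, b, c⟩ := v
  have hu := uRoot_spec hP hv
  simp only [Cf, normf] at hu
  exact θint_sub_mem_span hu

/-- **`n + ∛2 ∈ (α) ↔ N(α) ∣ n − k`**, `k = kRoot α`. [cite: HeathBrown2001LargestPrimeFactorCubic, Lemma 4] -/
theorem natCast_add_θint_mem_genIdeal_iff (hP : ∀ i, P i ⊆ basePairs X i) {v : ℕ × ℕ × ℕ}
    (hv : v ∈ gens X P) (n : ℕ) :
    (n : 𝓞 K) + θint ∈ genIdeal v ↔ (normNat v : ℤ) ∣ (n : ℤ) - kRoot v := by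
  obtain ⟨a, b, c⟩ := v
  have hu := uRoot_spec hP hv
  simp only [Cf, normf] at hu
  have h := natCast_add_θint_mem_span_iff (normf_pos_of_mem_gens hP hv) hu n
  rw [genIdeal, gen]
  rw [h, normNat_cast_of_mem_gens hP hv, kRoot, Bf, normf]
  simp only [sub_neg_eq_add]

/-- **`#𝒜_{(α)} = #{X < n ≤ 2X : N(α) ∣ n − k}`**. [cite: HeathBrown2001LargestPrimeFactorCubic, §3 p. 566] -/
theorem Acount_eq_card_filter (hP : ∀ i, P i ⊆ basePairs X i) {v : ℕ × ℕ × ℕ} (hv : v ∈ gens X P) :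
    Acount X v = #((Ioc X (2 * X)).filter fun n : ℕ => (normNat v : ℤ) ∣ (n : ℤ) - kRoot v) := by
  classical
  unfold Acount
  congr 1
  exact filter_congr (fun n _ => natCast_add_θint_mem_genIdeal_iff hP hv n)

/-- **(3.5) in real form**: for `α ∈ gens` and any real `Y`,
`(Y − k)/N(α) − (Y/N(α) − ab·w/q) − (−E/(qN(α))) ∈ ℤ`.
[cite: HeathBrown2001LargestPrimeFactorCubic, (3.5)] -/
theorem exists_int_phase (hP : ∀ i, P i ⊆ basePairs X i) {v : ℕ × ℕ × ℕ} (hv : v ∈ gens X P) (Y : ℝ) :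
    ∃ m : ℤ, (Y - kRoot v) / normNat v - (Y / normNat v - (v.1 : ℝ) * v.2.1 * wRoot v / qf v.1 v.2.1)
      - (-(Ef v : ℝ) / (qf v.1 v.2.1 * normNat v)) = m := by
  obtain ⟨h2, hC, hD⟩ := isCoprime_of_mem_gens hP hv
  have hu := uRoot_spec hP hv
  have hw := wRoot_spec hP hv
  have hNq := isCoprime_norm_q h2 hC hD
  obtain ⟨a, b, c⟩ := v
  simp only [Cf, normf, qf] at hu hw
  obtain ⟨m, hm⟩ := qN_dvd hNq hu hw
  refine ⟨-m, ?_⟩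
  have hN0 : (0 : ℝ) < normNat (a, b, c) := by exact_mod_cast normNat_pos_of_mem_gens hP hv
  have hNcast : ((normNat (a, b, c) : ℕ) : ℝ) = ((a : ℝ) ^ 3 + 2 * (b : ℝ) ^ 3 + 4 * (c : ℝ) ^ 3 - 6 * a * b * c) := by
    have := normNat_cast_of_mem_gens hP hv
    have h' : ((normNat (a, b, c) : ℤ) : ℝ) = ((normf (a, b, c) : ℤ) : ℝ) := by rw [this]
    simpa [normf] using h'
  obtain ⟨i, -, -, ha, hb, -, -⟩ := gens_spec hP hv
  have hq0 : (0 : ℝ) < qf a b :=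
    lt_of_le_of_lt (by have := tscale_nonneg X i; positivity) (qf_bounds (tscale_nonneg X i) ha hb).1
  have hqcast : ((qf a b : ℤ) : ℝ) = (a : ℝ) ^ 3 - 2 * (b : ℝ) ^ 3 := by simp [qf]
  -- clear denominators
  have hNr0 : ((normNat (a, b, c) : ℕ) : ℝ) ≠ 0 := hN0.ne'
  have hqr0 : ((qf a b : ℤ) : ℝ) ≠ 0 := hq0.ne'
  have hmR : (kRoot (a, b, c) : ℝ) * ((qf a b : ℤ) : ℝ) -
      (a : ℝ) * b * wRoot (a, b, c) * ((normNat (a, b, c) : ℕ) : ℝ) - (Ef (a, b, c) : ℝ) =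
      ((qf a b : ℤ) : ℝ) * ((normNat (a, b, c) : ℕ) : ℝ) * m := by
    have h' := congrArg (Int.cast : ℤ → ℝ) hm
    push_cast at h'
    rw [hNcast, hqcast, kRoot, Bf, Ef]
    push_cast
    linear_combination h'
  have e1 : (Y - kRoot (a, b, c)) / ((normNat (a, b, c) : ℕ) : ℝ) -
      (Y / ((normNat (a, b, c) : ℕ) : ℝ) - (a : ℝ) * b * wRoot (a, b, c) / ((qf a b : ℤ) : ℝ))
      - (-(Ef (a, b, c) : ℝ) / (((qf a b : ℤ) : ℝ) * ((normNat (a, b, c) : ℕ) : ℝ))) =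
      -((kRoot (a, b, c) : ℝ) * ((qf a b : ℤ) : ℝ) -
        (a : ℝ) * b * wRoot (a, b, c) * ((normNat (a, b, c) : ℕ) : ℝ) - (Ef (a, b, c) : ℝ)) /
        (((qf a b : ℤ) : ℝ) * ((normNat (a, b, c) : ℕ) : ℝ)) := by
    field_simp
    ring
  simp only
  rw [e1, hmR]
  field_simp
  push_cast
  ring

/-- In the cube: `0 < E ≤ 0.23 t³`. [folklore] -/
theorem Ef_bounds {t : ℝ} (ht : 0 ≤ t) {a b c : ℕ} (ha : a ∈ aRange t) (hb : b ∈ bcRange t)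
    (hc : c ∈ bcRange t) : 0 < (Ef (a, b, c) : ℝ) ∧ (Ef (a, b, c) : ℝ) ≤ 23 / 100 * t ^ 3 := by
  obtain ⟨ha1, ha2⟩ := mem_aRange ht ha
  obtain ⟨hb1, hb2⟩ := mem_bcRange ht hb
  obtain ⟨hc1, hc2⟩ := mem_bcRange ht hc
  have e : (Ef (a, b, c) : ℝ) = 2 * (a : ℝ) ^ 2 * c + 4 * b * (c : ℝ) ^ 2 - 4 * a * (b : ℝ) ^ 2 := by
    simp [Ef]
  rw [e]
  have hb0 : (0 : ℝ) ≤ b := Nat.cast_nonneg b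
  have hc0 : (0 : ℝ) ≤ c := Nat.cast_nonneg c
  have ht0 : 0 < t := lt_of_le_of_lt (by positivity) (lt_of_lt_of_le hb1 (by linarith))
  constructor
  · nlinarith [mul_pos ht0 ht0, pow_lt_pow_left₀ ha1 ht (by norm_num : (2:ℕ) ≠ 0),
      mul_le_mul ha2 (pow_le_pow_left₀ hb0 hb2 2) (by positivity) (by positivity),
      mul_pos (mul_pos ht0 ht0) ht0]
  · nlinarith [mul_pos ht0 ht0, pow_le_pow_left₀ (by positivity) ha2 2,
      mul_le_mul (pow_le_pow_left₀ (by positivity) ha2 2) hc2 hc0 (by positivity),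
      mul_le_mul hb2 (pow_le_pow_left₀ hc0 hc2 2) (by positivity) (by positivity),
      mul_pos (mul_pos ht0 ht0) ht0, mul_nonneg (mul_nonneg ht hb0) hb0]

/-- **`|E/(qN(α))| ≤ 1/(4X)`** for `α ∈ gens` (Heath-Brown: `O(N³M⁻⁶) = O(X⁻¹)`; here
`E ≤ 0.23t³`, `q ≥ 0.99t³`, `N(α) ≥ 0.93t³`, `t³ ≥ X^{1+3δ/2} ≥ X`).
[cite: HeathBrown2001LargestPrimeFactorCubic, §3 p. 568] -/
theorem abs_E_div_le (hP : ∀ i, P i ⊆ basePairs X i) (hX : 1 ≤ X) {v : ℕ × ℕ × ℕ} (hv : v ∈ gens X P) :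
    |(-(Ef v : ℝ) / (qf v.1 v.2.1 * normNat v))| ≤ 1 / (4 * X) := by
  obtain ⟨i, hi, -, ha, hb, hc, -⟩ := gens_spec hP hv
  obtain ⟨a, b, c⟩ := v
  have ht := tscale_nonneg X i
  obtain ⟨hE0, hE⟩ := Ef_bounds ht ha hb hc
  obtain ⟨hq, -⟩ := qf_bounds ht ha hb
  obtain ⟨hN, -⟩ := normf_bounds ht ha hb hc
  have eN : (normNat (a, b, c) : ℝ) = normf (a, b, c) := normNat_real_eq ht ha hb hc
  have hsc := mem_scales hi
  have hX1 : (1 : ℝ) ≤ X := by exact_mod_cast hX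
  have hXpow : (X : ℝ) ≤ (X : ℝ) ^ (1 + 3 * hbδ / 2) := by
    calc (X : ℝ) = (X : ℝ) ^ (1 : ℝ) := (Real.rpow_one _).symm
      _ ≤ (X : ℝ) ^ (1 + 3 * hbδ / 2) :=
          Real.rpow_le_rpow_of_exponent_le hX1 (by linarith [hbδ_pos])
  have ht3 : (X : ℝ) ≤ 93 / 100 * tscale X i ^ 3 := hXpow.trans hsc
  have hX0 : (0 : ℝ) < X := by exact_mod_cast hX
  simp only at hq ⊢
  rw [eN, abs_div, abs_neg, abs_of_pos hE0, abs_of_pos (by nlinarith)]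
  rw [div_le_div_iff₀ (by nlinarith) (by linarith)]
  nlinarith [mul_pos (lt_of_le_of_lt (by positivity) hq) (lt_of_le_of_lt (by positivity) hN)]

end Spec

/-! ### The family and its exponential sums -/

/-- The family `𝒥 = {c ∈ 𝒞(a,b) : e ∣ a + bj + cj²}` (the `c` of (4.3) in one class modulo
`e = N(KA)`). [cite: HeathBrown2001LargestPrimeFactorCubic, (4.3)] -/
def famF (X i : ℕ) (ab : ℕ × ℕ) (e j : ℕ) : Finset ℕ :=
  (cSet (tscale X i) ab.1 ab.2).filter fun c : ℕ =>
    (e : ℤ) ∣ (ab.1 : ℤ) + ab.2 * j + (c : ℤ) * (j : ℤ) ^ 2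

/-- `σ_{Y}(h) = ∑_{c ∈ 𝒥} e(h(Y/N(α_c) − ab w_c/q))` (Heath-Brown's `σ(n)` with `X' = Y`, up to
complex conjugation). [cite: HeathBrown2001LargestPrimeFactorCubic, Lemma 4 (σ(n))] -/
def sigmaF (X i : ℕ) (ab : ℕ × ℕ) (e j : ℕ) (Y : ℕ) (h : ℤ) : ℂ :=
  ∑ c ∈ famF X i ab e j,
    (𝐞 ((h : ℝ) * ((Y : ℝ) / normNat (ab.1, ab.2, c) -
      (ab.1 : ℝ) * ab.2 * wRoot (ab.1, ab.2, c) / qf ab.1 ab.2)) : ℂ)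

/-- Auxiliary fact `famF_subset` for this file's estimates. [folklore] -/
theorem famF_subset (X i : ℕ) (ab : ℕ × ℕ) (e j : ℕ) : famF X i ab e j ⊆ cSet (tscale X i) ab.1 ab.2 :=
  filter_subset _ _

/-- Auxiliary fact `mem_gens_of_mem_famF` for this file's estimates. [folklore] -/
theorem mem_gens_of_mem_famF {X : ℕ} {P : ℕ → Finset (ℕ × ℕ)} {i : ℕ} (hi : i ∈ scales X)
    {ab : ℕ × ℕ} (hab : ab ∈ P i) {e j c : ℕ} (hc : c ∈ famF X i ab e j) :
    (ab.1, ab.2, c) ∈ gens X P :=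
  mem_gens.2 ⟨i, hi, hab, famF_subset X i ab e j hc⟩

/-- **Lemma 4 for one family** ((2.9) combined with (3.5)): see the module docstring.
[cite: HeathBrown2001LargestPrimeFactorCubic, Lemma 4 (2.9) and (3.5)] -/
theorem abs_sum_Rv_le {X : ℕ} {P : ℕ → Finset (ℕ × ℕ)} (hP : ∀ i, P i ⊆ basePairs X i) (hX : 1 ≤ X)
    {i : ℕ} (hi : i ∈ scales X) {ab : ℕ × ℕ} (hab : ab ∈ P i) (e j : ℕ) {V : ℕ} (hV : 1 ≤ V) :
    |∑ c ∈ famF X i ab e j, Rv X (ab.1, ab.2, c)| ≤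
      ((1 / π) * ∑ ν ∈ Icc 1 V, ‖sigmaF X i ab e j X ν‖ / ν +
        3 * (2 + Real.log (2 * V + 1)) / (2 * V + 1) *
          ∑ h ∈ Icc (-((5 * (2 * V + 1) : ℕ) : ℤ)) (5 * (2 * V + 1) : ℕ), ‖sigmaF X i ab e j X h‖) +
      ((1 / π) * ∑ ν ∈ Icc 1 V, ‖sigmaF X i ab e j (2 * X) ν‖ / ν +
        3 * (2 + Real.log (2 * V + 1)) / (2 * V + 1) *
          ∑ h ∈ Icc (-((5 * (2 * V + 1) : ℕ) : ℤ)) (5 * (2 * V + 1) : ℕ), ‖sigmaF X i ab e j (2 * X) h‖) +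
      2 * ((#(famF X i ab e j) : ℝ) / (4 * X)) *
        (2 * V + 2 * π * (3 * (2 + Real.log (2 * V + 1)) / (2 * V + 1)) *
          ∑ h ∈ Icc (-((5 * (2 * V + 1) : ℕ) : ℤ)) (5 * (2 * V + 1) : ℕ), |(h : ℝ)|) := by
  set F := famF X i ab e j with hF
  set cV : ℝ := 3 * (2 + Real.log (2 * V + 1)) / (2 * V + 1) with hcV
  set HH : ℕ := 5 * (2 * V + 1) with hHH
  set B : ℝ := (#F : ℝ) / (4 * X) with hB
  have hV1 : (1 : ℝ) ≤ V := by exact_mod_cast hV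
  have hcV0 : 0 ≤ cV := by
    rw [hcV]; exact div_nonneg (by nlinarith [Real.log_nonneg (by linarith : (1:ℝ) ≤ 2 * V + 1)]) (by linarith)
  have hB0 : 0 ≤ B := by rw [hB]; positivity
  -- the remainders as counts
  have hmem : ∀ c ∈ F, (ab.1, ab.2, c) ∈ gens X P := fun c hc => mem_gens_of_mem_famF hi hab hc
  have hRv : ∀ c ∈ F, Rv X (ab.1, ab.2, c) =
      (#((Ioc X (2 * X)).filter fun n : ℕ =>
        ((normNat (ab.1, ab.2, c) : ℕ) : ℤ) ∣ (n : ℤ) - kRoot (ab.1, ab.2, c)) : ℝ) -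
        X / normNat (ab.1, ab.2, c) := by
    intro c hc
    rw [Rv, Acount_eq_card_filter hP (hmem c hc)]
  rw [sum_congr rfl hRv]
  have hN : ∀ c ∈ F, 0 < normNat (ab.1, ab.2, c) := fun c hc => normNat_pos_of_mem_gens hP (hmem c hc)
  refine (abs_sum_remainder_le F (fun c => normNat (ab.1, ab.2, c)) (fun c => kRoot (ab.1, ab.2, c))
    hN X hV).trans ?_
  -- replace the phases `(Y − k)/N` by `Y/N − abw/q`, with error `2π|h| B`
  have hphase : ∀ (Y : ℕ) (h : ℤ),
      ‖∑ c ∈ F, (𝐞 ((h : ℝ) * ((((Y : ℕ) : ℝ) - kRoot (ab.1, ab.2, c)) / normNat (ab.1, ab.2, c))) : ℂ)‖ ≤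
        ‖sigmaF X i ab e j Y h‖ + 2 * π * |(h : ℝ)| * B := by
    intro Y h
    have key := norm_sum_fourierChar_sub_le F
      (fun c => (((Y : ℕ) : ℝ) - kRoot (ab.1, ab.2, c)) / normNat (ab.1, ab.2, c))
      (fun c => ((Y : ℕ) : ℝ) / normNat (ab.1, ab.2, c) -
        (ab.1 : ℝ) * ab.2 * wRoot (ab.1, ab.2, c) / qf ab.1 ab.2)
      (fun c => -(Ef (ab.1, ab.2, c) : ℝ) / (qf ab.1 ab.2 * normNat (ab.1, ab.2, c)))
      (fun c hc => exists_int_phase hP (hmem c hc) Y) h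
    have herr : ∑ c ∈ F, |(-(Ef (ab.1, ab.2, c) : ℝ) / (qf ab.1 ab.2 * normNat (ab.1, ab.2, c)))| ≤
        (#F : ℝ) * (1 / (4 * X)) := by
      rw [← nsmul_eq_mul, ← sum_const]
      exact sum_le_sum (fun c hc => abs_E_div_le hP hX (hmem c hc))
    have hsig : sigmaF X i ab e j Y h = ∑ c ∈ F, (𝐞 ((h : ℝ) * (((Y : ℕ) : ℝ) / normNat (ab.1, ab.2, c) -
        (ab.1 : ℝ) * ab.2 * wRoot (ab.1, ab.2, c) / qf ab.1 ab.2)) : ℂ) := rfl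
    have htri := norm_sub_le_norm_sub_add_norm_sub
      (∑ c ∈ F, (𝐞 ((h : ℝ) * ((((Y : ℕ) : ℝ) - kRoot (ab.1, ab.2, c)) / normNat (ab.1, ab.2, c))) : ℂ))
      (sigmaF X i ab e j Y h) 0
    rw [sub_zero, sub_zero] at htri
    rw [hsig] at htri ⊢
    have hB' : 2 * π * |(h : ℝ)| * ((#F : ℝ) * (1 / (4 * X))) = 2 * π * |(h : ℝ)| * B := by
      rw [hB]; ring
    calc _ ≤ _ := htri
      _ ≤ 2 * π * |(h : ℝ)| * ((#F : ℝ) * (1 / (4 * X))) +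
          ‖∑ c ∈ F, (𝐞 ((h : ℝ) * (((Y : ℕ) : ℝ) / normNat (ab.1, ab.2, c) -
            (ab.1 : ℝ) * ab.2 * wRoot (ab.1, ab.2, c) / qf ab.1 ab.2)) : ℂ)‖ :=
            add_le_add_left (key.trans (mul_le_mul_of_nonneg_left herr (by positivity))) _
      _ = _ := by rw [hB', add_comm]
  -- assemble
  have hblock : ∀ Y : ℕ,
      (1 / π) * ∑ ν ∈ Icc 1 V, ‖∑ c ∈ F, (𝐞 ((ν : ℝ) * ((((Y : ℕ) : ℝ) - kRoot (ab.1, ab.2, c)) /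
          normNat (ab.1, ab.2, c))) : ℂ)‖ / ν +
        cV * ∑ d ∈ Icc (-(HH : ℤ)) HH, ‖∑ c ∈ F, (𝐞 ((d : ℝ) * ((((Y : ℕ) : ℝ) - kRoot (ab.1, ab.2, c)) /
          normNat (ab.1, ab.2, c))) : ℂ)‖ ≤
      ((1 / π) * ∑ ν ∈ Icc 1 V, ‖sigmaF X i ab e j Y ν‖ / ν +
        cV * ∑ h ∈ Icc (-(HH : ℤ)) HH, ‖sigmaF X i ab e j Y h‖) +
      B * (2 * V + 2 * π * cV * ∑ h ∈ Icc (-(HH : ℤ)) HH, |(h : ℝ)|) := by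
    intro Y
    have h1 : (1 / π) * ∑ ν ∈ Icc 1 V, ‖∑ c ∈ F, (𝐞 ((ν : ℝ) * ((((Y : ℕ) : ℝ) - kRoot (ab.1, ab.2, c)) /
          normNat (ab.1, ab.2, c))) : ℂ)‖ / ν ≤
        (1 / π) * ∑ ν ∈ Icc 1 V, ‖sigmaF X i ab e j Y ν‖ / ν + B * (2 * V) := by
      have hterm : ∀ ν ∈ Icc 1 V, ‖∑ c ∈ F, (𝐞 ((ν : ℝ) * ((((Y : ℕ) : ℝ) - kRoot (ab.1, ab.2, c)) /
          normNat (ab.1, ab.2, c))) : ℂ)‖ / ν ≤ ‖sigmaF X i ab e j Y ν‖ / ν + 2 * π * B := by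
        intro ν hν
        rw [mem_Icc] at hν
        have hν0 : (0 : ℝ) < ν := by exact_mod_cast hν.1
        have h := hphase Y ν
        have habs : |((ν : ℤ) : ℝ)| = ν := by push_cast; exact abs_of_pos hν0
        rw [habs] at h
        have : ‖∑ c ∈ F, (𝐞 (((ν : ℤ) : ℝ) * ((((Y : ℕ) : ℝ) - kRoot (ab.1, ab.2, c)) /
            normNat (ab.1, ab.2, c))) : ℂ)‖ / ν ≤ (‖sigmaF X i ab e j Y ν‖ + 2 * π * ν * B) / ν :=
          div_le_div_of_nonneg_right h hν0.le
        rw [add_div, show 2 * π * ν * B / ν = 2 * π * B by field_simp] at this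
        exact_mod_cast this
      calc (1 / π) * ∑ ν ∈ Icc 1 V, ‖∑ c ∈ F, (𝐞 ((ν : ℝ) * ((((Y : ℕ) : ℝ) - kRoot (ab.1, ab.2, c)) /
              normNat (ab.1, ab.2, c))) : ℂ)‖ / ν
          ≤ (1 / π) * ∑ ν ∈ Icc 1 V, (‖sigmaF X i ab e j Y ν‖ / ν + 2 * π * B) :=
            mul_le_mul_of_nonneg_left (sum_le_sum hterm) (by positivity)
        _ = (1 / π) * ∑ ν ∈ Icc 1 V, ‖sigmaF X i ab e j Y ν‖ / ν + B * (2 * V) := by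
            rw [sum_add_distrib, sum_const, Nat.card_Icc, nsmul_eq_mul, mul_add]
            have hπ : (π : ℝ) ≠ 0 := Real.pi_ne_zero
            field_simp
            push_cast
            ring
    have h2 : cV * ∑ d ∈ Icc (-(HH : ℤ)) HH, ‖∑ c ∈ F, (𝐞 ((d : ℝ) * ((((Y : ℕ) : ℝ) - kRoot (ab.1, ab.2, c)) /
          normNat (ab.1, ab.2, c))) : ℂ)‖ ≤
        cV * ∑ h ∈ Icc (-(HH : ℤ)) HH, ‖sigmaF X i ab e j Y h‖ +
          B * (2 * π * cV * ∑ h ∈ Icc (-(HH : ℤ)) HH, |(h : ℝ)|) := by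
      calc cV * ∑ d ∈ Icc (-(HH : ℤ)) HH, ‖∑ c ∈ F, (𝐞 ((d : ℝ) * ((((Y : ℕ) : ℝ) - kRoot (ab.1, ab.2, c)) /
              normNat (ab.1, ab.2, c))) : ℂ)‖
          ≤ cV * ∑ d ∈ Icc (-(HH : ℤ)) HH, (‖sigmaF X i ab e j Y d‖ + 2 * π * |(d : ℝ)| * B) :=
            mul_le_mul_of_nonneg_left (sum_le_sum (fun d _ => hphase Y d)) hcV0
        _ = _ := by
            rw [sum_add_distrib, mul_add, ← sum_mul, ← mul_sum]
            ring
    linarith [h1, h2]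
  have hX := hblock X
  have h2X := hblock (2 * X)
  simp only [hF, hcV, hHH, hB] at hX h2X ⊢
  linarith [hX, h2X]

end Literature.NumberTheory.Sieve.LargestPrimeFactorCubic
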